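/-
COR-CM (cell pub-hodgecm2, stage 2 of the Hodge ladder) — count-neutral KERNEL COMBINATORICS «field level of the SYLOW TRANSFER, V: every Galois CM field
of degree 8pᵏ (p an odd prime, k ≥ 1) with an automorphism of order 4pᵏ has EXACTLY φ₂(F) generating faces» (seat prover-pub-hodgecm2-b23-g52-0, binder
prover b23, gen 52; own census lane SYLOW TRANSFER, blanket `CorCM/FaceSylowTransfer*` HOME/INBOX.md l.23357).  Theorems only;
`Census/SylowTransferEightPrimePower.lean` (this seat), the field transfer `CorCM/FaceGenerationTransfer.lean` and the INT2-GEN socket are used BY NAME;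
nothing asserted.  `Interfaces.lean` (C1), every E term, B01, `Transposition/*`, `PortJoin/*`, `D2Bridge/*` untouched.
HONEST FRAMING: `HC_CM` is NOT proved, here or anywhere in the tree; this file produces no period and proves no face period for any field; §2 is
CONDITIONAL on the face periods exactly as the earlier sockets.
T5: n/a-class (hypothesis binders: `[F:ℚ] = 8pᵏ`, `p` an odd prime, `k ≥ 1`, an automorphism of order `4pᵏ` — inhabited by `ℚ(ζ₁₆)⁺(i)·L`, `D_{8pᵏ}`-,
`Q_{8pᵏ}`-, `D₄ × ℤ/pᵏ`-, `Q₈ × ℤ/pᵏ`-fields; resp. `[F:ℚ] = 8m`, `m ≥ 3` odd, an element of order `4m` in `GalT F` whose fourth power has only the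
conjugates `u⁴, u⁻⁴`; checker: self, 2026-08-25).
-/
import Summits.HodgeConjecture.CorCM.Census.SylowTransferEightPrimePower
import Summits.HodgeConjecture.CorCM.FaceSylowTransfer
import HarnessLib

/-!
# Field level of the Sylow transfer, V: degree `8pᵏ` with an automorphism of order `4pᵏ`

**`isLeast_card_faces_hgen_of_aut_orderOf_four_mul_prime_pow`**: a Galois CM field `F` of degree `8pᵏ` (`p` an odd prime, `k ≥ 1`) with an automorphism
`u₀` of order `4pᵏ` (Galois group `ℤ/8pᵏ`, `ℤ/4pᵏ × ℤ/2`, `D_{8pᵏ}`, `Q_{8pᵏ}`, `D₄ × ℤ/pᵏ`, `Q₈ × ℤ/pᵏ`, `ℤ/pᵏ ⋊ ℤ/8`, …; complex conjugation ANY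
central involution) has EXACTLY `φ₂(F)` generating faces (`Census/SylowTransferEightPrimePower.lean`); part III (`CorCM/FaceSylowTransferEightPrime.lean`)
was the case `k = 1`.  General odd `m`: the same under the CONJUGATION DICHOTOMY on `u⁴` (`…_of_orderOf_four_mul_odd`).  §2: the CONDITIONAL
Hodge-conjecture reading through the INT2-GEN socket.  `HC_CM` is NOT proved.

## References
* [Pohlmann1968] H. Pohlmann, Algebraic cycles on abelian varieties of complex multiplication type, Ann. of Math. 88 (1968), Thm 1.
* [Shimura1998] G. Shimura, Abelian Varieties with Complex Multiplication and Modular Functions, §6.2 Thm. 3, §8.1.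
-/

noncomputable section

open CategoryTheory NumberField NumberField.ComplexEmbedding
open Literature.AlgebraicGeometry Literature.AlgebraicGeometry.Motives Literature.AlgebraicGeometry.HodgeTheory
open Literature.AlgebraicGeometry.ComplexMultiplication Literature.AlgebraicGeometry.Milne1999
open Literature.NumberTheory.Automorphic
open Literature.NumberTheory.Automorphic.PicardCM
open Summit.HodgeConjecture.CorCM.Domination

namespace Summit.HodgeConjecture.CorCM.FaceSylowTransfer

open Summit.HodgeConjecture.CorCM.Prior.AllgGroup.RfwfAllgGroup
open Summit.HodgeConjecture.CorCM.Census.BlockParity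
open Summit.HodgeConjecture.CorCM.Census.Coinvariant
open Summit.HodgeConjecture.CorCM.Census
open Summit.HodgeConjecture.CorCM.FaceCensus.OddSlice (galTOfAut galTOfAut_mul galTOfAut_conjAut)

section Field

variable {F : Type} [Field F] [NumberField F]

/-! ## §1 Exactly `φ₂(F)` generating faces -/

/-- **DEGREE `8m` (`m ≥ 3` ODD), AN ELEMENT `u` OF ORDER `4m` IN THE GALOIS TRANSLATES WHOSE FOURTH POWER HAS ONLY THE CONJUGATES `u⁴, u⁻⁴`
⟹ EXACTLY `φ₂(F)` GENERATING FACES.** [folklore] -/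
theorem isLeast_card_faces_hgen_of_orderOf_four_mul_odd [IsCMField F] [IsGalois ℚ F] {m : ℕ} (hm : Odd m) (h3 : 3 ≤ m)
    (hdeg : Module.finrank ℚ F = 8 * m) (u : GalT F) (hord : orderOf u = 4 * m)
    (hdich : ∀ y : GalT F, y * u ^ 4 * y⁻¹ = u ^ 4 ∨ y * u ^ 4 * y⁻¹ = (u ^ 4)⁻¹) (σ₀ : F →+* ℂ) :
    IsLeast {n : ℕ | ∃ 𝒮 : Finset (Face F), 𝒮.card = n ∧
      ∀ f : Face F, lefChar f.corner (fun _ => ({σ₀} : Finset (F →+* ℂ))) ∈ AddSubgroup.closure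
        {a : Asym F | ∃ g ∈ (𝒮 : Set (Face F)), ∃ σ : F →+* ℂ, a = lefChar g.corner (fun _ => ({σ} : Finset (F →+* ℂ)))}}
      (fibreTwo (conjT : GalT F) conjT_mul_self) := by
  refine FaceTransfer.isLeast_card_faces_hgen_of_intrinsic _ ?_ (fun S₀ hS₀ hS => ?_) σ₀
  · obtain ⟨S, hS, hcard, hgen⟩ := (SylowTransfer.isLeast_card_gfaces_generate_fibreTwo_of_orderOf_four_mul_odd conjT hm h3
      ((FaceCensus.card_galT (F := F)).trans hdeg) u hord hdich conjT_mul_self conjT_ne_one FaceBasis.conjT_comm).1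
    exact ⟨S, hS, hcard.le, hgen⟩
  · exact fibreTwo_le_card conjT conjT_mul_self FaceBasis.conjT_comm S₀ (Submodule.span ℤ (pairSet conjT)) le_rfl hS₀
      (fun y hy => hS (gfaceSet_subset_hodgeSpan conjT conjT_mul_self hy))

/-- **DEGREE `8pᵏ`, AN ELEMENT OF ORDER `4pᵏ` IN THE GALOIS TRANSLATES ⟹ EXACTLY `φ₂(F)` GENERATING FACES** (`p` an odd prime, `k ≥ 1`). [folklore] -/
theorem isLeast_card_faces_hgen_of_orderOf_four_mul_prime_pow [IsCMField F] [IsGalois ℚ F] {p k : ℕ} (hp : p.Prime) (hp2 : p ≠ 2) (hk : 1 ≤ k)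
    (hdeg : Module.finrank ℚ F = 8 * p ^ k) (u : GalT F) (hord : orderOf u = 4 * p ^ k) (σ₀ : F →+* ℂ) :
    IsLeast {n : ℕ | ∃ 𝒮 : Finset (Face F), 𝒮.card = n ∧
      ∀ f : Face F, lefChar f.corner (fun _ => ({σ₀} : Finset (F →+* ℂ))) ∈ AddSubgroup.closure
        {a : Asym F | ∃ g ∈ (𝒮 : Set (Face F)), ∃ σ : F →+* ℂ, a = lefChar g.corner (fun _ => ({σ} : Finset (F →+* ℂ)))}}
      (fibreTwo (conjT : GalT F) conjT_mul_self) := by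
  refine FaceTransfer.isLeast_card_faces_hgen_of_intrinsic _ ?_ (fun S₀ hS₀ hS => ?_) σ₀
  · obtain ⟨S, hS, hcard, hgen⟩ := (SylowTransfer.isLeast_card_gfaces_generate_fibreTwo_of_card_eq_eight_mul_prime_pow conjT hp hp2 hk
      ((FaceCensus.card_galT (F := F)).trans hdeg) u hord conjT_mul_self conjT_ne_one FaceBasis.conjT_comm).1
    exact ⟨S, hS, hcard.le, hgen⟩
  · exact fibreTwo_le_card conjT conjT_mul_self FaceBasis.conjT_comm S₀ (Submodule.span ℤ (pairSet conjT)) le_rfl hS₀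
      (fun y hy => hS (gfaceSet_subset_hodgeSpan conjT conjT_mul_self hy))

/-- **… automorphism form**: `[F:ℚ] = 8pᵏ` and `u₀ ∈ Aut(F)` of order `4pᵏ`. [folklore] -/
theorem isLeast_card_faces_hgen_of_aut_orderOf_four_mul_prime_pow [IsCMField F] [IsGalois ℚ F] (σ₀ : F →+* ℂ) {p k : ℕ} (hp : p.Prime)
    (hp2 : p ≠ 2) (hk : 1 ≤ k) (hdeg : Module.finrank ℚ F = 8 * p ^ k) (u₀ : F ≃ₐ[ℚ] F) (hord : orderOf u₀ = 4 * p ^ k) :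
    IsLeast {n : ℕ | ∃ 𝒮 : Finset (Face F), 𝒮.card = n ∧
      ∀ f : Face F, lefChar f.corner (fun _ => ({σ₀} : Finset (F →+* ℂ))) ∈ AddSubgroup.closure
        {a : Asym F | ∃ g ∈ (𝒮 : Set (Face F)), ∃ σ : F →+* ℂ, a = lefChar g.corner (fun _ => ({σ} : Finset (F →+* ℂ)))}}
      (fibreTwo (conjT : GalT F) conjT_mul_self) := by
  set e : (F ≃ₐ[ℚ] F) ≃* GalT F := MulEquiv.mk' (galTOfAut σ₀) (galTOfAut_mul σ₀) with he
  have hord' : orderOf (e u₀) = 4 * p ^ k := by rw [← hord]; exact orderOf_injective e.toMonoidHom e.injective u₀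
  exact isLeast_card_faces_hgen_of_orderOf_four_mul_prime_pow hp hp2 hk hdeg (e u₀) hord' σ₀

/-- **… automorphism form of the dichotomy law**: `[F:ℚ] = 8m` (`m ≥ 3` odd), `u₀ ∈ Aut(F)` of order `4m`, every conjugate of `u₀⁴` equal to `u₀⁴` or
`u₀⁻⁴`. [folklore] -/
theorem isLeast_card_faces_hgen_of_aut_orderOf_four_mul_odd [IsCMField F] [IsGalois ℚ F] (σ₀ : F →+* ℂ) {m : ℕ} (hm : Odd m) (h3 : 3 ≤ m)
    (hdeg : Module.finrank ℚ F = 8 * m) (u₀ : F ≃ₐ[ℚ] F) (hord : orderOf u₀ = 4 * m)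
    (hdich : ∀ y : F ≃ₐ[ℚ] F, y * u₀ ^ 4 * y⁻¹ = u₀ ^ 4 ∨ y * u₀ ^ 4 * y⁻¹ = (u₀ ^ 4)⁻¹) :
    IsLeast {n : ℕ | ∃ 𝒮 : Finset (Face F), 𝒮.card = n ∧
      ∀ f : Face F, lefChar f.corner (fun _ => ({σ₀} : Finset (F →+* ℂ))) ∈ AddSubgroup.closure
        {a : Asym F | ∃ g ∈ (𝒮 : Set (Face F)), ∃ σ : F →+* ℂ, a = lefChar g.corner (fun _ => ({σ} : Finset (F →+* ℂ)))}}
      (fibreTwo (conjT : GalT F) conjT_mul_self) := by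
  set e : (F ≃ₐ[ℚ] F) ≃* GalT F := MulEquiv.mk' (galTOfAut σ₀) (galTOfAut_mul σ₀) with he
  have hord' : orderOf (e u₀) = 4 * m := by rw [← hord]; exact orderOf_injective e.toMonoidHom e.injective u₀
  refine isLeast_card_faces_hgen_of_orderOf_four_mul_odd hm h3 hdeg (e u₀) hord' (fun y => ?_) σ₀
  obtain ⟨y₀, rfl⟩ := e.surjective y
  rcases hdich y₀ with h | h
  · left
    have := congrArg e h
    simpa only [map_mul, map_pow, map_inv] using this
  · right
    have := congrArg e h
    simpa only [map_mul, map_pow, map_inv] using this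

end Field

/-! ## §2 The Hodge-conjecture reading through the INT2-GEN socket (conditional on the face periods) -/

/-- **HC for the slice of a Galois CM field of degree `8pᵏ` with an automorphism of order `4pᵏ`, from `φ₂(K)` face periods** (CONDITIONAL; `HC_CM` is
NOT proved). [cite: Shimura1998, §6.2 Theorem 3 and §6.1 Corollary of Theorem 2 (pp. 41–43)] [cite: Pohlmann1968, Thm. 1]
[cite: Milne1999LefschetzClasses, Thm. 3.2 and Cor. 4.5] [cite: MumfordAV1970, §19 Thm. 1 and p. 169] -/
theorem hodgeConjectureFor_of_aut_orderOf_four_mul_prime_pow_of_exists_facePeriod (K : CMField) [hGal : IsGalois ℚ K] (σ₀ : (K : Type) →+* ℂ)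
    {p k : ℕ} (hp : p.Prime) (hp2 : p ≠ 2) (hk : 1 ≤ k) (hdeg : Module.finrank ℚ K = 8 * p ^ k) (u₀ : (K : Type) ≃ₐ[ℚ] (K : Type))
    (hord : orderOf u₀ = 4 * p ^ k) :
    ∃ 𝒮 : Finset (Face K), 𝒮.card = fibreTwo (conjT : GalT K) conjT_mul_self ∧
      ((∀ f ∈ 𝒮, ∃ ι₁ : K →+* ℂ, f.Admissible ι₁ ∧ ∃ (V : HermSpace3 K ι₁) (σ : K →+* ℂ),
        (Model.picardCMUniverse exists_isReal_hodgeModel_holds hodgePQ_independent_of_hodgeModel_holds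
          BallQuotient.ballQuotientUniformised_holds cmAbelianVarietyRealised_holds).PeriodNV ι₁ V K f.psi σ) →
      ∀ {P B : AbelianVariety ℂ}, AbelianVariety.IsProductOf (fun B : AbelianVariety ℂ =>
        ∃ (E : Type) (_ : Field E) (_ : NumberField E) (_ : IsCMField E) (_ : E →+* (K : Type)) (Φ : CMType E)
          (ι : 𝓞 E →+* End B) (ϑ : E →+* Module.End ℂ (complexBetti B.X 1)),
          IsCMTypeRealisation Φ B ι ϑ) P →
      AVDominatedBy B P → HodgeConjectureFor B.dim B.X) := by
  obtain ⟨⟨𝒮, hcard, hgen⟩, -⟩ := isLeast_card_faces_hgen_of_aut_orderOf_four_mul_prime_pow (F := K) σ₀ hp hp2 hk hdeg u₀ hord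
  refine ⟨𝒮, hcard, fun h P B hP hB => ?_⟩
  have h6 : 6 ≤ Module.finrank ℚ K := by
    rw [hdeg]
    have h2 : 2 ≤ p := hp.two_le
    have : p ≤ p ^ k := Nat.le_self_pow (Nat.one_le_iff_ne_zero.mp hk) p
    omega
  exact hodgeConjectureFor_of_avDominatedBy_isProductOf_of_exists_facePeriod_on K h6 (𝒮 : Set (Face K)) σ₀ hgen
    (fun f hf => h f (Finset.mem_coe.mp hf)) hP hB

/-- **HC for the slice of a Galois CM field of degree `8m` (`m ≥ 3` odd) with an automorphism `u₀` of order `4m` whose fourth power has only the conjugates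
`u₀⁴, u₀⁻⁴`, from `φ₂(K)` face periods** (CONDITIONAL; `HC_CM` is NOT proved). [cite: Shimura1998, §6.2 Theorem 3 and §6.1 Corollary of Theorem 2
(pp. 41–43)] [cite: Pohlmann1968, Thm. 1] [cite: Milne1999LefschetzClasses, Thm. 3.2 and Cor. 4.5] [cite: MumfordAV1970, §19 Thm. 1 and p. 169] -/
theorem hodgeConjectureFor_of_aut_orderOf_four_mul_odd_of_exists_facePeriod (K : CMField) [hGal : IsGalois ℚ K] (σ₀ : (K : Type) →+* ℂ)
    {m : ℕ} (hm : Odd m) (h3 : 3 ≤ m) (hdeg : Module.finrank ℚ K = 8 * m) (u₀ : (K : Type) ≃ₐ[ℚ] (K : Type)) (hord : orderOf u₀ = 4 * m)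
    (hdich : ∀ y : (K : Type) ≃ₐ[ℚ] (K : Type), y * u₀ ^ 4 * y⁻¹ = u₀ ^ 4 ∨ y * u₀ ^ 4 * y⁻¹ = (u₀ ^ 4)⁻¹) :
    ∃ 𝒮 : Finset (Face K), 𝒮.card = fibreTwo (conjT : GalT K) conjT_mul_self ∧
      ((∀ f ∈ 𝒮, ∃ ι₁ : K →+* ℂ, f.Admissible ι₁ ∧ ∃ (V : HermSpace3 K ι₁) (σ : K →+* ℂ),
        (Model.picardCMUniverse exists_isReal_hodgeModel_holds hodgePQ_independent_of_hodgeModel_holds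
          BallQuotient.ballQuotientUniformised_holds cmAbelianVarietyRealised_holds).PeriodNV ι₁ V K f.psi σ) →
      ∀ {P B : AbelianVariety ℂ}, AbelianVariety.IsProductOf (fun B : AbelianVariety ℂ =>
        ∃ (E : Type) (_ : Field E) (_ : NumberField E) (_ : IsCMField E) (_ : E →+* (K : Type)) (Φ : CMType E)
          (ι : 𝓞 E →+* End B) (ϑ : E →+* Module.End ℂ (complexBetti B.X 1)),
          IsCMTypeRealisation Φ B ι ϑ) P →
      AVDominatedBy B P → HodgeConjectureFor B.dim B.X) := by
  obtain ⟨⟨𝒮, hcard, hgen⟩, -⟩ := isLeast_card_faces_hgen_of_aut_orderOf_four_mul_odd (F := K) σ₀ hm h3 hdeg u₀ hord hdich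
  refine ⟨𝒮, hcard, fun h P B hP hB => ?_⟩
  have h6 : 6 ≤ Module.finrank ℚ K := by rw [hdeg]; omega
  exact hodgeConjectureFor_of_avDominatedBy_isProductOf_of_exists_facePeriod_on K h6 (𝒮 : Set (Face K)) σ₀ hgen
    (fun f hf => h f (Finset.mem_coe.mp hf)) hP hB

end Summit.HodgeConjecture.CorCM.FaceSylowTransfer
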